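import Literature.Barriers.ABC.NoArithmeticDerivative
import Literature.NumberTheory.DiophantineGeometry.AbcWave0QualityFormProofs
import HarnessLib

/-!
# Small arithmetic derivatives from abc — core bookkeeping (Pasten 2021, towards Cor. 4.6)

`Literature/Barriers/ABC/NoArithmeticDerivativeSmallDerivCore.lean` — first of three companion
files discharging the named fact
`Literature.Barriers.ABC.Pasten.smallDerivatives_of_abcQualityForm`
(`Literature/Barriers/ABC/NoArithmeticDerivative.lean`): the Masser–Oesterlé abc conjecture
(`ABCQualityForm`) implies Pasten's Small Derivatives Conjecture [cite: Pasten2021, Cor. 4.6 with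
Thm. 4.5]. The discharge itself is `smallDerivatives_of_abcQualityForm_holds` in
`Literature.Barriers.ABC.NoArithmeticDerivativeProofs`.

This file sets up, for an abc triple `(a, b, c)` and `ψ : ℕ → ℤ` (the values `ψ(ξ_p)`):

* `logPart n ψ = Σ_{p ∣ n} v_p(n) ψ(p)/p`, so that `d^ψ n = n · logPart n ψ`
  (`arithDerivWith_eq_mul_logPart`);
* the additivity defect as an INTEGRAL linear form `linF ψ = Σ_{p ∣ abc} ± (n v_p(n)/p) ψ(p)`
  (`linF_cast : linF ψ = a S_a + b S_b − c S_c`, Pasten's (EqnAdd)), its coefficients `coef`,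
  and the range bound `abs_linF_le` on a cube;
* degeneracy `Degenerate a b c ψ :⇔ S_a = S_b = S_c` (Pasten's (EqnDepDep), i.e. `𝒯°(a,b)`),
  with `wronskian_ne_zero_of_not_degenerate` (`linF ψ = 0 ∧ ¬ Degenerate → W^ψ(a,b) ≠ 0`);
* the divisibility `Degenerate.dvd_factorization`: `p ∣ v_p(abc) ψ(p)` for degenerate `ψ`
  [cite: Pasten2021, proof of Lemma 4.4], via `rad(n) · S_n = I_n ∈ ℤ` and coprime radicals;
* `Degenerate.eq_zero_of_support_pair`: a degenerate `ψ` supported on two primes lying in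
  different members of the triple vanishes;
* `exists_of_sepPair` ("Case A"): two primes `p, p'` in different members give the explicit
  non-degenerate `ψ = ±coef(p') e_p ∓ coef(p) e_{p'} ∈ 𝒯(a,b)` of norm `max(coef p, coef p')`.

All statements here are elementary bookkeeping [folklore] around [cite: Pasten2021, §§2.1–2.4, 4.2].
-/

open Finset

namespace Literature.Barriers.ABC.Pasten

open Literature.NumberTheory.DiophantineGeometry

/-! ### The logarithmic part `S_n(ψ)` of an arithmetic derivative -/

/-- `logPart n ψ = Σ_{p ∣ n} v_p(n) · ψ(p) / p ∈ ℚ`, so that `d^ψ(n) = n · logPart n ψ`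
(Pasten's `Σ_{p|n} v_p(n) p⁻¹ ψ(ξ_p)`). [cite: Pasten2021, §2.2 eq. (EqnAdd)] -/
noncomputable def logPart (n : ℕ) (ψ : ℕ → ℤ) : ℚ :=
  ∑ p ∈ n.primeFactors, (n.factorization p : ℚ) * ψ p / p

/-- `d^ψ(n) = n · logPart n ψ`. [cite: Pasten2021, §2.1] -/
theorem arithDerivWith_eq_mul_logPart (ψ : ℕ → ℤ) (n : ℕ) :
    arithDerivWith ψ n = n * logPart n ψ := by
  unfold arithDerivWith logPart
  simp only [Finsupp.sum, Nat.support_factorization]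

/-- `logPart` is additive in `ψ`. [folklore] -/
theorem logPart_sub (n : ℕ) (ψ ψ' : ℕ → ℤ) :
    logPart n (ψ - ψ') = logPart n ψ - logPart n ψ' := by
  unfold logPart
  rw [← Finset.sum_sub_distrib]
  refine Finset.sum_congr rfl fun p _ => ?_
  simp only [Pi.sub_apply, Int.cast_sub]
  ring

/-- `logPart n ψ` only depends on the values of `ψ` at the primes of `n`. [folklore] -/
theorem logPart_congr {n : ℕ} {ψ ψ' : ℕ → ℤ} (h : ∀ p ∈ n.primeFactors, ψ p = ψ' p) :
    logPart n ψ = logPart n ψ' := by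
  unfold logPart
  exact Finset.sum_congr rfl fun p hp => by rw [h p hp]

/-- If `ψ` vanishes on the primes of `n` then `logPart n ψ = 0`. [folklore] -/
theorem logPart_eq_zero_of_forall {n : ℕ} {ψ : ℕ → ℤ} (h : ∀ p ∈ n.primeFactors, ψ p = 0) :
    logPart n ψ = 0 := by
  unfold logPart
  exact Finset.sum_eq_zero fun p hp => by rw [h p hp]; simp

/-- If `ψ` vanishes on the primes of `n` other than `q ∈ n.primeFactors`, then
`logPart n ψ = v_q(n) ψ(q) / q`. [folklore] -/
theorem logPart_eq_single {n q : ℕ} {ψ : ℕ → ℤ} (hq : q ∈ n.primeFactors)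
    (h : ∀ p ∈ n.primeFactors, p ≠ q → ψ p = 0) :
    logPart n ψ = (n.factorization q : ℚ) * ψ q / q := by
  unfold logPart
  rw [Finset.sum_eq_single q (fun p hp hpq => by rw [h p hp hpq]; simp) (fun hq' => absurd hq hq')]

/-- A single-term `logPart` vanishes only if the value does: `v_q(n) ψ(q)/q = 0 → ψ q = 0`
for `q ∈ n.primeFactors`. [folklore] -/
theorem eq_zero_of_logPart_single_eq_zero {n q : ℕ} {ψ : ℕ → ℤ} (hq : q ∈ n.primeFactors)
    (h : ∀ p ∈ n.primeFactors, p ≠ q → ψ p = 0) (h0 : logPart n ψ = 0) : ψ q = 0 := by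
  rw [logPart_eq_single hq h] at h0
  have hqp : (q : ℚ) ≠ 0 := by exact_mod_cast (Nat.prime_of_mem_primeFactors hq).ne_zero
  have hk : (n.factorization q : ℚ) ≠ 0 := by
    exact_mod_cast (Nat.pos_of_ne_zero fun h' => by
      rw [← Nat.support_factorization, Finsupp.mem_support_iff] at hq; exact hq h').ne'
  rw [div_eq_zero_iff, mul_eq_zero] at h0
  rcases h0 with (h0 | h0) | h0
  · exact absurd h0 hk
  · exact_mod_cast h0
  · exact absurd h0 hqp

/-! ### Degenerate derivations: `S_a = S_b = S_c` -/

/-- `ψ` is *degenerate* for `(a, b, c)` if `S_a(ψ) = S_b(ψ) = S_c(ψ)`; for `ψ ∈ 𝒯(a,b)` this is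
`ψ ∈ 𝒯°(a,b)` (Pasten: "(EqnAdd) and (EqnDep) together are equivalent to (EqnDepDep)").
[cite: Pasten2021, §4.2 eq. (EqnDepDep)] -/
def Degenerate (a b c : ℕ) (ψ : ℕ → ℤ) : Prop :=
  logPart a ψ = logPart b ψ ∧ logPart b ψ = logPart c ψ

/-- If `ψ` is degenerate and one of `S_a, S_b, S_c` vanishes, all three vanish. [folklore] -/
theorem Degenerate.all_zero {a b c : ℕ} {ψ : ℕ → ℤ} (hD : Degenerate a b c ψ)
    (h0 : logPart a ψ = 0 ∨ logPart b ψ = 0 ∨ logPart c ψ = 0) :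
    logPart a ψ = 0 ∧ logPart b ψ = 0 ∧ logPart c ψ = 0 := by
  obtain ⟨h1, h2⟩ := hD
  rcases h0 with h0 | h0 | h0
  · exact ⟨h0, h1 ▸ h0, h2 ▸ h1 ▸ h0⟩
  · exact ⟨h1 ▸ h0, h0, h2 ▸ h0⟩
  · exact ⟨h1 ▸ h2 ▸ h0, h2 ▸ h0, h0⟩

section Divisibility

/-- `radOf n = ∏_{p ∣ n} p`, the radical of `n` as a product over `n.primeFactors`
(`= UniqueFactorizationMonoid.radical n`, `Nat.radical_eq_prod_primeFactors`). [folklore] -/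
def radOf (n : ℕ) : ℕ := ∏ p ∈ n.primeFactors, p

/-- `coradOf n q = ∏_{p ∣ n, p ≠ q} p` (`= rad(n)/q` for `q ∣ n`). [folklore] -/
def coradOf (n q : ℕ) : ℕ := ∏ p ∈ n.primeFactors.erase q, p

/-- The integer `I_n(ψ) = Σ_{p ∣ n} v_p(n) ψ(p) · rad(n)/p`, so that `S_n(ψ) = I_n(ψ)/rad(n)`.
[folklore] -/
def intPart (n : ℕ) (ψ : ℕ → ℤ) : ℤ :=
  ∑ p ∈ n.primeFactors, (n.factorization p : ℤ) * ψ p * (coradOf n p : ℤ)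

/-- `rad(n) = q · (rad(n)/q)` for `q ∣ n` prime. [folklore] -/
theorem radOf_eq_mul_coradOf {n q : ℕ} (hq : q ∈ n.primeFactors) :
    radOf n = q * coradOf n q := by
  unfold radOf coradOf
  exact (Finset.mul_prod_erase n.primeFactors (fun p => p) hq).symm

/-- `rad(n) ∣ n`. [folklore] -/
theorem radOf_dvd (n : ℕ) : radOf n ∣ n := Nat.prod_primeFactors_dvd n

/-- `rad(n) · S_n(ψ) = I_n(ψ)`. [folklore] -/
theorem radOf_mul_logPart (n : ℕ) (ψ : ℕ → ℤ) :
    (radOf n : ℚ) * logPart n ψ = intPart n ψ := by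
  unfold logPart intPart
  rw [Finset.mul_sum]
  push_cast
  refine Finset.sum_congr rfl fun p hp => ?_
  have hp0 : (p : ℚ) ≠ 0 := by exact_mod_cast (Nat.prime_of_mem_primeFactors hp).ne_zero
  rw [radOf_eq_mul_coradOf hp]
  push_cast
  field_simp

/-- If `S_n(ψ) = S_{n'}(ψ)` for coprime `n, n'`, then `rad(n) ∣ I_n(ψ)` (the common value has
denominator dividing both radicals). [cite: Pasten2021, proof of Lemma 4.4] -/
theorem radOf_dvd_intPart_of_logPart_eq {n n' : ℕ} (hcop : Nat.Coprime n n') {ψ : ℕ → ℤ}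
    (h : logPart n ψ = logPart n' ψ) : (radOf n : ℤ) ∣ intPart n ψ := by
  have key : (intPart n ψ : ℚ) * radOf n' = intPart n' ψ * radOf n := by
    rw [← radOf_mul_logPart, ← radOf_mul_logPart, h]
    ring
  have key' : intPart n ψ * radOf n' = intPart n' ψ * radOf n := by exact_mod_cast key
  have hcop' : IsCoprime (radOf n : ℤ) (radOf n' : ℤ) := by
    rw [Nat.isCoprime_iff_coprime]
    exact Nat.Coprime.of_dvd (radOf_dvd n) (radOf_dvd n') hcop
  refine hcop'.dvd_of_dvd_mul_right (z := (radOf n' : ℤ)) ?_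
  rw [key']
  exact Dvd.intro_left _ rfl

/-- If `rad(n) ∣ I_n(ψ)` then `p ∣ v_p(n) ψ(p)` for every prime `p ∣ n` (reduce `I_n` mod `p`:
all other terms contain the factor `p`, and `p ∤ rad(n)/p`). [cite: Pasten2021, proof of Lemma 4.4] -/
theorem dvd_of_radOf_dvd_intPart {n : ℕ} {ψ : ℕ → ℤ} (h : (radOf n : ℤ) ∣ intPart n ψ)
    {p : ℕ} (hp : p ∈ n.primeFactors) : (p : ℤ) ∣ (n.factorization p : ℤ) * ψ p := by
  have hpP : Nat.Prime p := Nat.prime_of_mem_primeFactors hp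
  have hpZ : Prime (p : ℤ) := Nat.prime_iff_prime_int.mp hpP
  have h1 : (p : ℤ) ∣ intPart n ψ :=
    dvd_trans (by rw [radOf_eq_mul_coradOf hp]; push_cast; exact Dvd.intro _ rfl) h
  have hsplit : intPart n ψ = (n.factorization p : ℤ) * ψ p * (coradOf n p : ℤ) +
      ∑ p' ∈ n.primeFactors.erase p, (n.factorization p' : ℤ) * ψ p' * (coradOf n p' : ℤ) := by
    unfold intPart
    exact (Finset.add_sum_erase n.primeFactors
      (fun p' => (n.factorization p' : ℤ) * ψ p' * (coradOf n p' : ℤ)) hp).symm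
  have h2 : (p : ℤ) ∣ ∑ p' ∈ n.primeFactors.erase p,
      (n.factorization p' : ℤ) * ψ p' * (coradOf n p' : ℤ) := by
    refine Finset.dvd_sum fun p' hp' => ?_
    refine Dvd.dvd.mul_left ?_ _
    have hmem : p ∈ n.primeFactors.erase p' :=
      Finset.mem_erase.mpr ⟨(Finset.mem_erase.mp hp').1.symm, hp⟩
    unfold coradOf
    exact_mod_cast Finset.dvd_prod_of_mem (fun q : ℕ => q) hmem
  have h3 : (p : ℤ) ∣ (n.factorization p : ℤ) * ψ p * (coradOf n p : ℤ) :=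
    (dvd_add_left h2).mp (hsplit ▸ h1)
  have h4 : ¬ (p : ℤ) ∣ (coradOf n p : ℤ) := by
    intro hd
    have hd' : p ∣ coradOf n p := by exact_mod_cast hd
    unfold coradOf at hd'
    rw [Prime.dvd_finsetProd_iff hpP.prime] at hd'
    obtain ⟨q, hq, hpq⟩ := hd'
    have hqP : Nat.Prime q := Nat.prime_of_mem_primeFactors (Finset.mem_of_mem_erase hq)
    have : p = q := (Nat.prime_dvd_prime_iff_eq hpP hqP).mp hpq
    exact (Finset.mem_erase.mp hq).1 this.symm
  rcases hpZ.dvd_or_dvd h3 with h5 | h5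
  · exact h5
  · exact absurd h5 h4

end Divisibility

variable {a b c : ℕ}

/-- `gcd(a, c) = 1` for an abc triple. [folklore] -/
theorem coprime_ac (h : IsABCTriple a b c) : Nat.Coprime a c := by
  obtain ⟨-, -, rfl, hab⟩ := h
  exact Nat.coprime_self_add_right.mpr hab

/-- `gcd(b, c) = 1` for an abc triple. [folklore] -/
theorem coprime_bc (h : IsABCTriple a b c) : Nat.Coprime b c := by
  obtain ⟨-, -, rfl, hab⟩ := h
  exact Nat.coprime_add_self_right.mpr hab.symm

/-- The primes of `abc` are those of `a`, of `b` and of `c`. [folklore] -/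
theorem primeFactors_abc (h : IsABCTriple a b c) :
    (a * b * c).primeFactors = a.primeFactors ∪ b.primeFactors ∪ c.primeFactors := by
  obtain ⟨ha, hb, habc, -⟩ := h
  have hc : c ≠ 0 := by omega
  rw [Nat.primeFactors_mul (mul_ne_zero ha.ne' hb.ne') hc, Nat.primeFactors_mul ha.ne' hb.ne']

/-- A prime factor of `n` does not divide a number coprime to `n`. [folklore] -/
theorem not_dvd_of_mem_primeFactors_of_coprime {m n p : ℕ} (hmn : Nat.Coprime m n)
    (hp : p ∈ n.primeFactors) : ¬ p ∣ m := by
  intro hpm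
  have hpP := Nat.prime_of_mem_primeFactors hp
  have : p ∣ Nat.gcd m n := Nat.dvd_gcd hpm (Nat.dvd_of_mem_primeFactors hp)
  rw [hmn] at this
  exact hpP.one_lt.ne' (Nat.dvd_one.mp this)

/-- **Pasten's divisibility for `𝒯°(a,b)`**: if `ψ` is degenerate for the abc triple `(a,b,c)`,
then `p ∣ v_p(n) · ψ(p)` for every prime `p` of each member `n ∈ {a, b, c}` ("considering the
denominators in (EqnDepDep), we see that for each `p ∣ abc` ... `p` divides `v_p(abc)ψ(ξ_p)`").
[cite: Pasten2021, proof of Lemma 4.4] -/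
theorem Degenerate.dvd (h : IsABCTriple a b c) {ψ : ℕ → ℤ} (hD : Degenerate a b c ψ) :
    (∀ p ∈ a.primeFactors, (p : ℤ) ∣ (a.factorization p : ℤ) * ψ p) ∧
    (∀ p ∈ b.primeFactors, (p : ℤ) ∣ (b.factorization p : ℤ) * ψ p) ∧
    (∀ p ∈ c.primeFactors, (p : ℤ) ∣ (c.factorization p : ℤ) * ψ p) := by
  refine ⟨fun p hp => ?_, fun p hp => ?_, fun p hp => ?_⟩
  · exact dvd_of_radOf_dvd_intPart (radOf_dvd_intPart_of_logPart_eq h.2.2.2 hD.1) hp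
  · exact dvd_of_radOf_dvd_intPart (radOf_dvd_intPart_of_logPart_eq h.2.2.2.symm hD.1.symm) hp
  · exact dvd_of_radOf_dvd_intPart
      (radOf_dvd_intPart_of_logPart_eq (coprime_ac h).symm (hD.1.trans hD.2).symm) hp

/-- `v_p(abc) = v_p(a)` for `p ∣ a`, and similarly for `b`, `c` (pairwise coprimality).
[folklore] -/
theorem factorization_abc (h : IsABCTriple a b c) (p : ℕ) :
    (p ∈ a.primeFactors → (a * b * c).factorization p = a.factorization p) ∧
    (p ∈ b.primeFactors → (a * b * c).factorization p = b.factorization p) ∧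
    (p ∈ c.primeFactors → (a * b * c).factorization p = c.factorization p) := by
  obtain ⟨ha, hb, habc, hab⟩ := h
  have hc : c ≠ 0 := by omega
  have h' : IsABCTriple a b c := ⟨ha, hb, habc, hab⟩
  have hmul : (a * b * c).factorization p =
      a.factorization p + b.factorization p + c.factorization p := by
    rw [Nat.factorization_mul (mul_ne_zero ha.ne' hb.ne') hc, Nat.factorization_mul ha.ne' hb.ne']
    rfl
  have za : p ∉ a.primeFactors → a.factorization p = 0 := fun hp => by
    rwa [← Nat.support_factorization, Finsupp.notMem_support_iff] at hp
  have zb : p ∉ b.primeFactors → b.factorization p = 0 := fun hp => by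
    rwa [← Nat.support_factorization, Finsupp.notMem_support_iff] at hp
  have zc : p ∉ c.primeFactors → c.factorization p = 0 := fun hp => by
    rwa [← Nat.support_factorization, Finsupp.notMem_support_iff] at hp
  have dab := hab.disjoint_primeFactors
  have dac := (coprime_ac h').disjoint_primeFactors
  have dbc := (coprime_bc h').disjoint_primeFactors
  refine ⟨fun hp => ?_, fun hp => ?_, fun hp => ?_⟩
  · rw [hmul, zb (Finset.disjoint_left.mp dab hp), zc (Finset.disjoint_left.mp dac hp)]; simp
  · rw [hmul, za (Finset.disjoint_right.mp dab hp), zc (Finset.disjoint_left.mp dbc hp)]; simp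
  · rw [hmul, za (Finset.disjoint_right.mp dac hp), zb (Finset.disjoint_right.mp dbc hp)]; simp

/-- Divisibility, uniform form: `p ∣ v_p(abc) ψ(p)` for every `p ∣ abc` when `ψ` is degenerate.
[cite: Pasten2021, proof of Lemma 4.4] -/
theorem Degenerate.dvd_factorization (h : IsABCTriple a b c) {ψ : ℕ → ℤ}
    (hD : Degenerate a b c ψ) {p : ℕ} (hp : p ∈ (a * b * c).primeFactors) :
    (p : ℤ) ∣ ((a * b * c).factorization p : ℤ) * ψ p := by
  obtain ⟨dA, dB, dC⟩ := hD.dvd h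
  obtain ⟨fA, fB, fC⟩ := factorization_abc h p
  rw [primeFactors_abc h, Finset.mem_union, Finset.mem_union] at hp
  rcases hp with (hp | hp) | hp
  · rw [fA hp]; exact dA p hp
  · rw [fB hp]; exact dB p hp
  · rw [fC hp]; exact dC p hp

/-- Two primes `q₁, q₂` *lie in different members* of the triple: no member of `{a, b, c}` is
divisible by both. [folklore] -/
def SepPair (a b c q₁ q₂ : ℕ) : Prop :=
  ¬ (q₁ ∈ a.primeFactors ∧ q₂ ∈ a.primeFactors) ∧ ¬ (q₁ ∈ b.primeFactors ∧ q₂ ∈ b.primeFactors) ∧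
    ¬ (q₁ ∈ c.primeFactors ∧ q₂ ∈ c.primeFactors)

/-- Two primes of `abc` in different members leave some member free of both. [folklore] -/
theorem SepPair.free (h : IsABCTriple a b c) {q₁ q₂ : ℕ} (hs : SepPair a b c q₁ q₂)
    (h₁ : q₁ ∈ (a * b * c).primeFactors) (h₂ : q₂ ∈ (a * b * c).primeFactors) :
    (q₁ ∉ a.primeFactors ∧ q₂ ∉ a.primeFactors) ∨ (q₁ ∉ b.primeFactors ∧ q₂ ∉ b.primeFactors) ∨
      (q₁ ∉ c.primeFactors ∧ q₂ ∉ c.primeFactors) := by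
  have dab := h.2.2.2.disjoint_primeFactors
  have dac := (coprime_ac h).disjoint_primeFactors
  have dbc := (coprime_bc h).disjoint_primeFactors
  obtain ⟨sa, sb, sc⟩ := hs
  rw [primeFactors_abc h, Finset.mem_union, Finset.mem_union] at h₁ h₂
  rcases h₁ with (h₁ | h₁) | h₁ <;> rcases h₂ with (h₂ | h₂) | h₂
  · exact absurd ⟨h₁, h₂⟩ sa
  · exact Or.inr (Or.inr ⟨Finset.disjoint_left.mp dac h₁, Finset.disjoint_left.mp dbc h₂⟩)
  · exact Or.inr (Or.inl ⟨Finset.disjoint_left.mp dab h₁, Finset.disjoint_right.mp dbc h₂⟩)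
  · exact Or.inr (Or.inr ⟨Finset.disjoint_left.mp dbc h₁, Finset.disjoint_left.mp dac h₂⟩)
  · exact absurd ⟨h₁, h₂⟩ sb
  · exact Or.inl ⟨Finset.disjoint_right.mp dab h₁, Finset.disjoint_right.mp dac h₂⟩
  · exact Or.inr (Or.inl ⟨Finset.disjoint_right.mp dbc h₁, Finset.disjoint_left.mp dab h₂⟩)
  · exact Or.inl ⟨Finset.disjoint_right.mp dac h₁, Finset.disjoint_right.mp dab h₂⟩
  · exact absurd ⟨h₁, h₂⟩ sc

/-- The two primes of a `SepPair` are distinct. [folklore] -/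
theorem SepPair.ne (h : IsABCTriple a b c) {q₁ q₂ : ℕ} (hs : SepPair a b c q₁ q₂)
    (h₁ : q₁ ∈ (a * b * c).primeFactors) : q₁ ≠ q₂ := by
  rintro rfl
  obtain ⟨sa, sb, sc⟩ := hs
  rw [primeFactors_abc h, Finset.mem_union, Finset.mem_union] at h₁
  rcases h₁ with (h₁ | h₁) | h₁
  · exact sa ⟨h₁, h₁⟩
  · exact sb ⟨h₁, h₁⟩
  · exact sc ⟨h₁, h₁⟩

/-- **Determinedness**: a degenerate `ψ` vanishing at all primes of `abc` except possibly two
primes `q₁, q₂` lying in different members vanishes at every prime of `abc`. (Some member contains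
neither, so its `S` vanishes, hence all `S` vanish, and a member containing exactly one of them
reads off that value.) [folklore] -/
theorem Degenerate.eq_zero_of_support_pair (h : IsABCTriple a b c) {ψ : ℕ → ℤ}
    (hD : Degenerate a b c ψ) {q₁ q₂ : ℕ} (hq₁ : q₁ ∈ (a * b * c).primeFactors)
    (hq₂ : q₂ ∈ (a * b * c).primeFactors) (hsep : SepPair a b c q₁ q₂)
    (hsupp : ∀ p ∈ (a * b * c).primeFactors, p ≠ q₁ → p ≠ q₂ → ψ p = 0) :
    ∀ p ∈ (a * b * c).primeFactors, ψ p = 0 := by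
  have hfree := hsep.free h hq₁ hq₂
  have hJ := primeFactors_abc h
  have hsuppA : ∀ n ∈ ({a, b, c} : Finset ℕ), ∀ p ∈ n.primeFactors, p ≠ q₁ → p ≠ q₂ → ψ p = 0 := by
    intro n hn p hp h1 h2
    refine hsupp p ?_ h1 h2
    rw [hJ]
    simp only [Finset.mem_insert, Finset.mem_singleton] at hn
    rcases hn with rfl | rfl | rfl <;> simp [hp]
  have hzero : logPart a ψ = 0 ∧ logPart b ψ = 0 ∧ logPart c ψ = 0 := by
    refine hD.all_zero ?_
    rcases hfree with ⟨h1, h2⟩ | ⟨h1, h2⟩ | ⟨h1, h2⟩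
    · refine Or.inl (logPart_eq_zero_of_forall fun p hp => hsuppA a (by simp) p hp ?_ ?_) <;>
        rintro rfl <;> contradiction
    · refine Or.inr (Or.inl (logPart_eq_zero_of_forall fun p hp => hsuppA b (by simp) p hp ?_ ?_)) <;>
        rintro rfl <;> contradiction
    · refine Or.inr (Or.inr (logPart_eq_zero_of_forall fun p hp => hsuppA c (by simp) p hp ?_ ?_)) <;>
        rintro rfl <;> contradiction
  have hkill : ∀ n ∈ ({a, b, c} : Finset ℕ), logPart n ψ = 0 → ∀ q ∈ n.primeFactors,
      (q = q₁ ∨ q = q₂) → (q₁ ∈ n.primeFactors → q₂ ∈ n.primeFactors → False) → ψ q = 0 := by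
    intro n hn hS q hq hq12 hnot
    refine eq_zero_of_logPart_single_eq_zero hq (fun p hp hpq => ?_) hS
    rcases hq12 with rfl | rfl
    · exact hsuppA n hn p hp hpq fun h' => hnot hq (h' ▸ hp)
    · exact hsuppA n hn p hp (fun h' => hnot (h' ▸ hp) hq) hpq
  obtain ⟨sa, sb, sc⟩ := hsep
  intro p hp
  by_cases hp1 : p = q₁
  · subst hp1
    rw [hJ, Finset.mem_union, Finset.mem_union] at hp
    rcases hp with (hp | hp) | hp
    · exact hkill a (by simp) hzero.1 p hp (Or.inl rfl) fun h1 h2 => sa ⟨h1, h2⟩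
    · exact hkill b (by simp) hzero.2.1 p hp (Or.inl rfl) fun h1 h2 => sb ⟨h1, h2⟩
    · exact hkill c (by simp) hzero.2.2 p hp (Or.inl rfl) fun h1 h2 => sc ⟨h1, h2⟩
  by_cases hp2 : p = q₂
  · subst hp2
    rw [hJ, Finset.mem_union, Finset.mem_union] at hp
    rcases hp with (hp | hp) | hp
    · exact hkill a (by simp) hzero.1 p hp (Or.inr rfl) fun h1 h2 => sa ⟨h1, h2⟩
    · exact hkill b (by simp) hzero.2.1 p hp (Or.inr rfl) fun h1 h2 => sb ⟨h1, h2⟩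
    · exact hkill c (by simp) hzero.2.2 p hp (Or.inr rfl) fun h1 h2 => sc ⟨h1, h2⟩
  exact hsupp p hp hp1 hp2

/-! ### Members, coefficients, signs; the linear form `linF` -/

/-- The member of the triple `(a, b, c)` that the prime `p ∣ abc` divides. [folklore] -/
def memberOf (a b c p : ℕ) : ℕ := if p ∣ a then a else if p ∣ b then b else c

/-- The integer coefficient `(n/p) · v_p(n)` (`n` the member `p` divides) of `ψ(ξ_p)` in the
additivity equation (EqnAdd). [cite: Pasten2021, §2.2 eq. (EqnAdd)] -/
def coef (a b c p : ℕ) : ℕ := memberOf a b c p / p * (memberOf a b c p).factorization p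

/-- The sign with which the `p`-term enters `d^ψ a + d^ψ b − d^ψ c`: `−1` for `p ∣ c`, else `+1`.
[folklore] -/
def sgn (c p : ℕ) : ℤ := if p ∣ c then -1 else 1

/-- The additivity defect as an integral linear form in the unknowns `ψ(ξ_p)`, `p ∣ abc`:
`linF ψ = Σ_{p ∣ abc} ± (n v_p(n)/p) ψ(p)` (`= d^ψ a + d^ψ b − d^ψ c`, see `linF_cast`).
[cite: Pasten2021, §2.2 eq. (EqnAdd)] -/
def linF (a b c : ℕ) (ψ : ℕ → ℤ) : ℤ :=
  ∑ p ∈ (a * b * c).primeFactors, sgn c p * coef a b c p * ψ p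

/-- The sum of all coefficients of (EqnAdd) (Pasten bounds each by `c log₂(c)/2`).
[cite: Pasten2021, proof of Thm. 2.6] -/
def coefSum (a b c : ℕ) : ℕ := ∑ p ∈ (a * b * c).primeFactors, coef a b c p

/-- `memberOf p = a` for `p ∣ a`. [folklore] -/
theorem memberOf_of_mem_a {p : ℕ} (hp : p ∈ a.primeFactors) : memberOf a b c p = a := by
  simp [memberOf, Nat.dvd_of_mem_primeFactors hp]

/-- `memberOf p = b` for `p ∣ b`. [folklore] -/
theorem memberOf_of_mem_b (h : IsABCTriple a b c) {p : ℕ} (hp : p ∈ b.primeFactors) :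
    memberOf a b c p = b := by
  simp [memberOf, not_dvd_of_mem_primeFactors_of_coprime h.2.2.2 hp, Nat.dvd_of_mem_primeFactors hp]

/-- `memberOf p = c` for `p ∣ c`. [folklore] -/
theorem memberOf_of_mem_c (h : IsABCTriple a b c) {p : ℕ} (hp : p ∈ c.primeFactors) :
    memberOf a b c p = c := by
  simp [memberOf, not_dvd_of_mem_primeFactors_of_coprime (coprime_ac h) hp,
    not_dvd_of_mem_primeFactors_of_coprime (coprime_bc h) hp]

/-- `p` is a prime factor of its member, and the member is one of `a, b, c`, hence `≤ c`.
[folklore] -/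
theorem mem_primeFactors_memberOf (h : IsABCTriple a b c) {p : ℕ}
    (hp : p ∈ (a * b * c).primeFactors) :
    p ∈ (memberOf a b c p).primeFactors ∧ memberOf a b c p ≤ c ∧
      (memberOf a b c p).factorization p = (a * b * c).factorization p := by
  obtain ⟨fA, fB, fC⟩ := factorization_abc h p
  have hac : a ≤ c := by obtain ⟨-, -, habc, -⟩ := h; omega
  have hbc : b ≤ c := by obtain ⟨-, -, habc, -⟩ := h; omega
  rw [primeFactors_abc h, Finset.mem_union, Finset.mem_union] at hp
  rcases hp with (hp | hp) | hp
  · rw [memberOf_of_mem_a hp]; exact ⟨hp, hac, (fA hp).symm⟩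
  · rw [memberOf_of_mem_b h hp]; exact ⟨hp, hbc, (fB hp).symm⟩
  · rw [memberOf_of_mem_c h hp]; exact ⟨hp, le_rfl, (fC hp).symm⟩

/-- Coefficients of (EqnAdd) are positive integers. [cite: Pasten2021, proof of Thm. 2.6] -/
theorem coef_pos (h : IsABCTriple a b c) {p : ℕ} (hp : p ∈ (a * b * c).primeFactors) :
    0 < coef a b c p := by
  obtain ⟨hm, -, -⟩ := mem_primeFactors_memberOf h hp
  unfold coef
  refine Nat.mul_pos (Nat.div_pos (Nat.le_of_dvd ?_ (Nat.dvd_of_mem_primeFactors hm))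
    (Nat.prime_of_mem_primeFactors hm).pos) ?_
  · exact Nat.pos_of_ne_zero (Nat.mem_primeFactors.mp hm).2.2
  · exact Nat.pos_of_ne_zero fun h' => by
      rw [← Nat.support_factorization, Finsupp.mem_support_iff] at hm; exact hm h'

/-- Coefficient bound: `coef p ≤ c · v_p(abc)` (crudely, `n/p ≤ c`). [folklore] -/
theorem coef_le (h : IsABCTriple a b c) {p : ℕ} (hp : p ∈ (a * b * c).primeFactors) :
    coef a b c p ≤ c * (a * b * c).factorization p := by
  obtain ⟨-, hle, hfac⟩ := mem_primeFactors_memberOf h hp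
  unfold coef
  rw [hfac]
  exact Nat.mul_le_mul_right _ ((Nat.div_le_self _ _).trans hle)

/-- `sgn p = 1` for `p ∣ a`. [folklore] -/
theorem sgn_of_mem_a (h : IsABCTriple a b c) {p : ℕ} (hp : p ∈ a.primeFactors) : sgn c p = 1 := by
  simp [sgn, not_dvd_of_mem_primeFactors_of_coprime (coprime_ac h).symm hp]

/-- `sgn p = 1` for `p ∣ b`. [folklore] -/
theorem sgn_of_mem_b (h : IsABCTriple a b c) {p : ℕ} (hp : p ∈ b.primeFactors) : sgn c p = 1 := by
  simp [sgn, not_dvd_of_mem_primeFactors_of_coprime (coprime_bc h).symm hp]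

/-- `sgn p = −1` for `p ∣ c`. [folklore] -/
theorem sgn_of_mem_c {p : ℕ} (hp : p ∈ c.primeFactors) : sgn c p = -1 := by
  simp [sgn, Nat.dvd_of_mem_primeFactors hp]

/-- `|sgn p| = 1`. [folklore] -/
theorem abs_sgn (c p : ℕ) : |sgn c p| = 1 := by
  unfold sgn; split_ifs <;> simp

/-- The generic term computation: for `p ∣ n`, `n · (v_p(n) ψ(p) / p) = ((n/p) v_p(n)) · ψ(p)`.
[folklore] -/
theorem member_mul_term {n p : ℕ} (hp : p ∈ n.primeFactors) (ψ : ℕ → ℤ) :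
    (n : ℚ) * ((n.factorization p : ℚ) * ψ p / p) =
      ((n / p * n.factorization p : ℕ) : ℚ) * ψ p := by
  have hp0 : (p : ℚ) ≠ 0 := by exact_mod_cast (Nat.prime_of_mem_primeFactors hp).ne_zero
  push_cast
  rw [Nat.cast_div (Nat.dvd_of_mem_primeFactors hp) hp0]
  field_simp

/-- `n · S_n(ψ) = Σ_{p ∣ n} ((n/p) v_p(n)) ψ(p)` (this is `d^ψ(n) ∈ ℤ`). [cite: Pasten2021, §1.1] -/
theorem member_mul_logPart (n : ℕ) (ψ : ℕ → ℤ) :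
    (n : ℚ) * logPart n ψ = ∑ p ∈ n.primeFactors, ((n / p * n.factorization p : ℕ) : ℚ) * ψ p := by
  unfold logPart
  rw [Finset.mul_sum]
  exact Finset.sum_congr rfl fun p hp => member_mul_term hp ψ

/-- **`linF` is the additivity defect**: `linF ψ = a S_a + b S_b − c S_c = d^ψ a + d^ψ b − d^ψ c`
as rationals. [cite: Pasten2021, §2.2 eq. (EqnAdd)] -/
theorem linF_cast (h : IsABCTriple a b c) (ψ : ℕ → ℤ) :
    (linF a b c ψ : ℚ) = a * logPart a ψ + b * logPart b ψ - c * logPart c ψ := by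
  have hdab : Disjoint a.primeFactors b.primeFactors := h.2.2.2.disjoint_primeFactors
  have hdac : Disjoint a.primeFactors c.primeFactors := (coprime_ac h).disjoint_primeFactors
  have hdbc : Disjoint b.primeFactors c.primeFactors := (coprime_bc h).disjoint_primeFactors
  unfold linF
  rw [primeFactors_abc h, Finset.sum_union (Finset.disjoint_union_left.mpr ⟨hdac, hdbc⟩),
    Finset.sum_union hdab]
  push_cast
  rw [member_mul_logPart, member_mul_logPart, member_mul_logPart]
  have ea : ∑ p ∈ a.primeFactors, ((sgn c p : ℚ) * (coef a b c p : ℚ) * (ψ p : ℚ)) =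
      ∑ p ∈ a.primeFactors, ((a / p * a.factorization p : ℕ) : ℚ) * ψ p :=
    Finset.sum_congr rfl fun p hp => by rw [sgn_of_mem_a h hp, coef, memberOf_of_mem_a hp]; simp
  have eb : ∑ p ∈ b.primeFactors, ((sgn c p : ℚ) * (coef a b c p : ℚ) * (ψ p : ℚ)) =
      ∑ p ∈ b.primeFactors, ((b / p * b.factorization p : ℕ) : ℚ) * ψ p :=
    Finset.sum_congr rfl fun p hp => by rw [sgn_of_mem_b h hp, coef, memberOf_of_mem_b h hp]; simp
  have ec : ∑ p ∈ c.primeFactors, ((sgn c p : ℚ) * (coef a b c p : ℚ) * (ψ p : ℚ)) =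
      -∑ p ∈ c.primeFactors, ((c / p * c.factorization p : ℕ) : ℚ) * ψ p := by
    rw [← Finset.sum_neg_distrib]
    exact Finset.sum_congr rfl fun p hp => by rw [sgn_of_mem_c hp, coef, memberOf_of_mem_c h hp]; simp
  rw [ea, eb, ec]
  ring

/-- `linF` is additive. [folklore] -/
theorem linF_sub (ψ ψ' : ℕ → ℤ) : linF a b c (ψ - ψ') = linF a b c ψ - linF a b c ψ' := by
  unfold linF
  rw [← Finset.sum_sub_distrib]
  exact Finset.sum_congr rfl fun p _ => by simp only [Pi.sub_apply]; ring

/-- `linF ψ` only depends on `ψ` at the primes of `abc`. [folklore] -/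
theorem linF_congr {ψ ψ' : ℕ → ℤ} (hψ : ∀ p ∈ (a * b * c).primeFactors, ψ p = ψ' p) :
    linF a b c ψ = linF a b c ψ' := by
  unfold linF
  exact Finset.sum_congr rfl fun p hp => by rw [hψ p hp]

/-- Range of `linF` on the cube `[0, H]`: `|linF ψ| ≤ H · coefSum`. [folklore] -/
theorem abs_linF_le {ψ : ℕ → ℤ} {H : ℕ}
    (hψ : ∀ p ∈ (a * b * c).primeFactors, 0 ≤ ψ p ∧ ψ p ≤ H) :
    |linF a b c ψ| ≤ H * coefSum a b c := by
  unfold linF coefSum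
  push_cast
  rw [Finset.mul_sum]
  refine (Finset.abs_sum_le_sum_abs _ _).trans (Finset.sum_le_sum fun p hp => ?_)
  rw [abs_mul, abs_mul, abs_sgn, one_mul, Nat.abs_cast, abs_of_nonneg (hψ p hp).1]
  have := (hψ p hp).2
  nlinarith [(Nat.cast_nonneg (α := ℤ) (coef a b c p))]

/-- `ψ ∈ 𝒯(a,b)` from `linF ψ = 0`: additivity on the chosen equation `a + b = c`.
[cite: Pasten2021, §2.2] -/
theorem additive_of_linF_eq_zero (h : IsABCTriple a b c) {ψ : ℕ → ℤ} (hF : linF a b c ψ = 0) :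
    arithDerivWith ψ (a + b) = arithDerivWith ψ a + arithDerivWith ψ b := by
  have hid := linF_cast h ψ
  rw [hF, Int.cast_zero] at hid
  rw [h.2.2.1, arithDerivWith_eq_mul_logPart, arithDerivWith_eq_mul_logPart,
    arithDerivWith_eq_mul_logPart]
  linarith

/-- **Independence from non-degeneracy**: if `linF ψ = 0` and `ψ` is not degenerate then
`W^ψ(a,b) ≠ 0` (Pasten: (EqnAdd) ∧ (EqnDep) ⟺ (EqnDepDep)). [cite: Pasten2021, §2.4 and §4.2] -/
theorem wronskian_ne_zero_of_not_degenerate (h : IsABCTriple a b c) {ψ : ℕ → ℤ}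
    (hF : linF a b c ψ = 0) (hnd : ¬ Degenerate a b c ψ) : wronskian ψ a b ≠ 0 := by
  intro hW
  have hid := linF_cast h ψ
  rw [hF, Int.cast_zero] at hid
  obtain ⟨ha, hb, habc, -⟩ := h
  have ha' : (a : ℚ) ≠ 0 := by exact_mod_cast ha.ne'
  have hb' : (b : ℚ) ≠ 0 := by exact_mod_cast hb.ne'
  have hc' : (c : ℚ) ≠ 0 := by exact_mod_cast (show c ≠ 0 by omega)
  unfold wronskian at hW
  rw [arithDerivWith_eq_mul_logPart, arithDerivWith_eq_mul_logPart] at hW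
  have hab : logPart a ψ = logPart b ψ := by
    have : (a : ℚ) * b * (logPart b ψ - logPart a ψ) = 0 := by linarith
    rcases mul_eq_zero.mp this with h1 | h1
    · exact absurd h1 (mul_ne_zero ha' hb')
    · linarith
  apply hnd
  refine ⟨hab, ?_⟩
  have hcq : (c : ℚ) = a + b := by exact_mod_cast habc.symm
  have : (c : ℚ) * (logPart b ψ - logPart c ψ) = 0 := by
    rw [hab] at hid; linear_combination -hid + logPart b ψ * hcq
  rcases mul_eq_zero.mp this with h1 | h1
  · exact absurd h1 hc'
  · linarith

/-! ### Case A: two primes in different members -/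

/-- **Explicit small derivation from two primes in different members** ("Case A"): if
`p, p' ∣ abc` lie in different members of the triple, then
`ψ = sgn(p') coef(p') · e_p − sgn(p) coef(p) · e_{p'}` is supported on the primes of `abc`,
satisfies (EqnAdd) (`linF ψ = 0`), is NOT degenerate, and has `‖ψ‖ ≤ max (coef p) (coef p')`.
(E.g. for `(2ˢ, q, r)` with primes `q, r`: `ψ(ξ_q) = 1 = ψ(ξ_r)`.) [folklore] -/
theorem exists_of_sepPair (h : IsABCTriple a b c) {p p' : ℕ} (hp : p ∈ (a * b * c).primeFactors)
    (hp' : p' ∈ (a * b * c).primeFactors) (hsep : SepPair a b c p p') :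
    ∃ ψ : ℕ → ℤ, (∀ q, q ∉ (a * b * c).primeFactors → ψ q = 0) ∧ linF a b c ψ = 0 ∧
      ¬ Degenerate a b c ψ ∧ ∀ q, |ψ q| ≤ max (coef a b c p) (coef a b c p') := by
  have hne : p ≠ p' := hsep.ne h hp
  set ψ : ℕ → ℤ := fun q => if q = p then sgn c p' * coef a b c p'
    else if q = p' then -(sgn c p * coef a b c p) else 0 with hψ
  have hψp : ψ p = sgn c p' * coef a b c p' := by simp [hψ]
  have hψp' : ψ p' = -(sgn c p * coef a b c p) := by simp [hψ, hne.symm]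
  have hψ0 : ∀ q, q ≠ p → q ≠ p' → ψ q = 0 := fun q h1 h2 => by simp [hψ, h1, h2]
  refine ⟨ψ, fun q hq => hψ0 q (fun h' => hq (h' ▸ hp)) (fun h' => hq (h' ▸ hp')), ?_, ?_, ?_⟩
  · unfold linF
    rw [Finset.sum_eq_add_of_mem p p' hp hp' hne (fun q _ hq => by rw [hψ0 q hq.1 hq.2]; simp),
      hψp, hψp']
    ring
  · intro hD
    have h0 := hD.eq_zero_of_support_pair h hp hp' hsep (fun q _ h1 h2 => hψ0 q h1 h2) p hp
    rw [hψp] at h0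
    have h1 : (coef a b c p' : ℤ) ≠ 0 := by exact_mod_cast (coef_pos h hp').ne'
    have h2 : sgn c p' ≠ 0 := abs_ne_zero.mp (by rw [abs_sgn]; exact one_ne_zero)
    exact mul_ne_zero h2 h1 h0
  · intro q
    by_cases h1 : q = p
    · subst h1
      rw [hψp, abs_mul, abs_sgn, one_mul, Nat.abs_cast]
      exact_mod_cast le_max_right _ _
    by_cases h2 : q = p'
    · subst h2
      rw [hψp', abs_neg, abs_mul, abs_sgn, one_mul, Nat.abs_cast]
      exact_mod_cast le_max_left _ _
    rw [hψ0 q h1 h2, abs_zero]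
    positivity


/-! ### Data for the cube pigeonhole (used in `NoArithmeticDerivativeSmallDerivCube`) -/

/-- The product of the "bad" primes of `abc`: those `p` with `p ∣ v_p(abc)` (for which the
divisibility `p ∣ v_p(abc) ψ(p)` of a degenerate `ψ` carries no information; Pasten's factor
`∏_{p ∣ abc} v_p(abc)` in Lemma 4.4 plays the same role). [cite: Pasten2021, Lemma 4.4] -/
def badProd (a b c : ℕ) : ℕ :=
  ∏ p ∈ (a * b * c).primeFactors with p ∣ (a * b * c).factorization p, p

/-- Extension by zero of a vector indexed by the primes of `abc` to a function on `ℕ`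
(the values `ψ(ξ_p)`, `ψ` supported on `supp(abc)`). [folklore] -/
def extJ (a b c : ℕ) (x : (a * b * c).primeFactors → ℤ) : ℕ → ℤ :=
  fun p => if hp : p ∈ (a * b * c).primeFactors then x ⟨p, hp⟩ else 0

/-- `extJ x p = x p` on the primes of `abc`. [folklore] -/
theorem extJ_apply_mem {x : (a * b * c).primeFactors → ℤ} {p : ℕ}
    (hp : p ∈ (a * b * c).primeFactors) : extJ a b c x p = x ⟨p, hp⟩ := by
  simp [extJ, hp]

/-- `extJ x p = 0` off the primes of `abc`. [folklore] -/
theorem extJ_apply_not_mem {x : (a * b * c).primeFactors → ℤ} {p : ℕ}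
    (hp : p ∉ (a * b * c).primeFactors) : extJ a b c x p = 0 := by
  simp [extJ, hp]

/-- `extJ` is additive. [folklore] -/
theorem extJ_sub (x y : (a * b * c).primeFactors → ℤ) :
    extJ a b c (x - y) = extJ a b c x - extJ a b c y := by
  funext p
  by_cases hp : p ∈ (a * b * c).primeFactors
  · simp [extJ, hp]
  · simp [extJ, hp]

end Literature.Barriers.ABC.Pasten
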